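import Summits.HodgeConjecture.HodgeConjecture.Theorems.K2E5QuatLocalCoordinatesDefs     -- [J1] E1 (p855861): `quatBasisLocal`, `quatLocalCoordMap`, `quatLocalCoord`, `quatLocalCoordLattice`
import Literature.NumberTheory.Automorphic.QuadraticAdeleBaseChange                    -- ★ `baseChange_apply_placesOver` (`(a ⊗ 1)_w = ι_w(a_v)`)
import HarnessLib

/-!
# K2 ∕ E5 «TamagawaUnitary» — [J1] companion `K2E5QuatLocalCoordCompat`: ADELIC ↔ LOCAL compatibility of the quaternion coordinates, and integrality of the coordinate lattice

Cell `hodgecm-mathlib` (Track B «K2-LIT»), engine E5, item h413 = `stmt-HodgeConjecture-24833` (`--supports`, helper); dealt BY NAME by K2E5-plan (g2), DEALS BATCH #10 (1)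
(2026-09-03T23:43:23Z, ruling (R1)); author K2E5-p19 (g0).  THEOREMS ONLY over the defs leaf ★ `K2E5QuatLocalCoordinatesDefs` (E1) and ★ p16 `K2E5QuatAdelicCoordinates`:

* §1 `adeleToLocal_baseChange` — `(a ⊗ 1)|_v = ι_v(a_v)` for an adele `a` of `L⁺` (★ `baseChange_apply_placesOver`, place by place).
* §2 **`map_adeleToLocal_quatCoord`** — the square «global coordinates, then restrict to `v`» = «restrict to `v`, then local coordinates»:
  `(quatCoord L e a).map (adeleToLocal L v) = quatLocalCoordMap L v hHa hdet (fun i ↦ (a i)_v)`, and its `≃`-form `coe_quatCoordEquiv_map_adeleToLocal`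
  (`(quatCoordEquiv a).map adeleToLocal = (quatLocalCoord (a_v)).1`).
* §3 INTEGRALITY: `smul_mem_intMatrices` bookkeeping, **`quatLocalCoordLattice_le_quatLocalOrder`** (`M_v(h) ⊆ Λ_v` as soon as the basis matrices `eᵢ ⊗ 1` are `v`-integral), and
  **`eventually_quatBasisLocal_mem_intMatrices`** ∕ **`eventually_quatLocalCoordLattice_le_quatLocalOrder`**: this holds for all but finitely many `v` (each entry of each `eᵢ ∈ M₂(L)`
  is `w`-integral off the finite support `HeightOneSpectrum.Support.finite`, and every `w` lies over one `v`).
  -- TODO(next edition, with Gvol): the reverse inclusion `det(Gram_trd(e)) • Λ_v ⊆ M_v(h)` (reduced-trace coordinates, ★ `K2E5QuatGramNondegenerate`) — commensurability and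
  -- `M_v(h) = Λ_v` off the support of `det Gram_trd(e)`.

HONEST LABEL: HC_CM is proved only modulo the 7 printed citations (2 remaining named inputs: hLiu418 = stmt-HodgeConjecture-24832,
h413 = stmt-HodgeConjecture-24833) until rung 0 closes; this file is local∕adelic bookkeeping and asserts nothing toward any count.

## References
* [VignerasLNM800] M.-F. Vignéras, *Arithmétique des algèbres de quaternions*, LNM 800 (1980) — Ch. III §1 (`X_A = ∏' X_v`; `𝒪_v = 𝒪 ⊗ R_v` is the completed order for almost all `v`).
* [CasselsFrohlichANT1967] J. W. S. Cassels, A. Fröhlich (eds.), *Algebraic Number Theory* (1967) — Ch. II §10 (`L ⊗_K K_v = Π_{w∣v} L_w`), §14 (adeles under base change).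
* [Weil1982] A. Weil, *Adeles and Algebraic Groups*, PM 23 (1982) — Ch. IV §4.4 p. 91.
-/

set_option autoImplicit false
set_option linter.dupNamespace false

noncomputable section

namespace Summit.HodgeConjecture.HodgeConjecture.Cruxes.H413.K2E5QuatLocalCoordinates

open NumberField IsDedekindDomain TopologicalSpace
open scoped Matrix
open Literature.NumberTheory.Automorphic Literature.NumberTheory.Automorphic.UnitaryGroup
open Literature.NumberTheory.Weil1982.UnitaryFinTopForm
open Summit.HodgeConjecture.HodgeConjecture.Cruxes.H413.K2E5QuatAdelicMatrixModel
open Summit.HodgeConjecture.HodgeConjecture.Cruxes.H413.K2E5QuatZeta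
open Summit.HodgeConjecture.HodgeConjecture.Cruxes.H413.K2E5QuatAdelicCoordinates
open Summit.HodgeConjecture.HodgeConjecture.Cruxes.H413.K2E5QuatLocalMeasure

variable (L : Type) [Field L] [NumberField L] [IsCMField L] {Ha : Matrix (Fin 2) (Fin 2) L} (v : HeightOneSpectrum (𝓞 ↥(maximalRealSubfield L)))

/-! ## §1 `(a ⊗ 1)|_v = ι_v(a_v)` -/

omit [IsCMField L] in
/-- **`(a ⊗ 1)|_v = ι_v(a_v)`**: the components above `v` of the base change of an adele `a` of `L⁺` are the images of its `v`-component under `ι_v` (★ `baseChange_apply_placesOver`).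
[cite: CasselsFrohlichANT1967, Ch. II §10] -/
theorem adeleToLocal_baseChange (a : AdeleRing (𝓞 ↥(maximalRealSubfield L)) ↥(maximalRealSubfield L)) :
    adeleToLocal L v (Literature.NumberTheory.Automorphic.AdeleRing.baseChange (↥(maximalRealSubfield L)) L a) =
      algebraMap (v.adicCompletion ↥(maximalRealSubfield L)) (LocalRing L v) (a.2 v) := by
  funext w
  rw [adeleToLocal_apply, AdeleRing.baseChange_snd, algebraMap_localRing_eq, toLocalRing_apply]
  exact baseChange_apply_placesOver L _ w

/-! ## §2 Global coordinates restricted to `v` = local coordinates of the `v`-components -/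

omit [IsCMField L] in
/-- `(c • X).map (adeleToLocal) = adeleToLocal c • X.map adeleToLocal` (a ring map on entries). [folklore] -/
theorem map_adeleToLocal_smul (c : AdeleRing (𝓞 L) L) (X : Matrix (Fin 2) (Fin 2) (AdeleRing (𝓞 L) L)) :
    (c • X).map (adeleToLocal L v) = adeleToLocal L v c • X.map (adeleToLocal L v) :=
  Matrix.map_smul' _ _ _ (map_mul (adeleToLocal L v))

/-- **ADELIC ↔ LOCAL COMPATIBILITY of the quaternion coordinates**: restricting the global coordinate matrix `quatCoord L e a = ∑ (aᵢ ⊗ 1)(eᵢ ⊗ 1)` (★ p16∕#3g, basis `e = quatBasis`)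
to the places above `v` gives the local coordinate matrix of the `v`-components, `quatLocalCoordMap L v hHa hdet (aᵥ) = ∑ ι_v(aᵢ,ᵥ)(eᵢ ⊗ 1)`.
[cite: VignerasLNM800, Ch. III §1 (X_A → X_v)] [cite: CasselsFrohlichANT1967, Ch. II §14] -/
theorem map_adeleToLocal_quatCoord (hHa : (Ha.map (cmConjRingHom L)).transpose = Ha) (hdet : Ha.det ≠ 0)
    (a : Fin 4 → AdeleRing (𝓞 ↥(maximalRealSubfield L)) ↥(maximalRealSubfield L)) :
    (quatCoord L (fun i => ((quatBasis L Ha hHa hdet i : ↥(quatRatSubalgebra L Ha)) : Matrix (Fin 2) (Fin 2) L)) a).map (adeleToLocal L v) =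
      quatLocalCoordMap L v hHa hdet (fun i => (a i).2 v) := by
  rw [quatCoord_apply, quatLocalCoordMap_apply, ← RingHom.mapMatrix_apply, map_sum]
  refine Finset.sum_congr rfl fun i _ => ?_
  rw [RingHom.mapMatrix_apply, map_adeleToLocal_smul, adeleToLocal_baseChange, quatBasisLocal_apply]
  exact congrArg _ (adelicForm_map_adeleToLocal L v _)

/-- The same square for the packaged equivalences: `(quatCoordEquiv a)|_v = quatLocalCoord (a_v)` (underlying matrices). [cite: VignerasLNM800, Ch. III §1] -/
theorem coe_quatCoordEquiv_map_adeleToLocal (hHa : (Ha.map (cmConjRingHom L)).transpose = Ha) (hdet : Ha.det ≠ 0)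
    (a : Fin 4 → AdeleRing (𝓞 ↥(maximalRealSubfield L)) ↥(maximalRealSubfield L)) :
    ((quatCoordEquiv L hHa hdet a : ↥(quatAdelic L Ha)) : Matrix (Fin 2) (Fin 2) (AdeleRing (𝓞 L) L)).map (adeleToLocal L v) =
      (quatLocalCoord L v hHa hdet (fun i => (a i).2 v)).1 := by
  rw [coe_quatCoordEquiv, coe_quatLocalCoord, map_adeleToLocal_quatCoord]

/-- Evaluation form: for `x ∈ D_{h,𝔸}` with global coordinates `a = quatCoordEquiv⁻¹ x`, the restriction `x|_v` has local coordinates `a_v`. [cite: VignerasLNM800, Ch. III §1] -/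
theorem map_adeleToLocal_eq_quatLocalCoordMap_symm (hHa : (Ha.map (cmConjRingHom L)).transpose = Ha) (hdet : Ha.det ≠ 0) (x : ↥(quatAdelic L Ha)) :
    (x : Matrix (Fin 2) (Fin 2) (AdeleRing (𝓞 L) L)).map (adeleToLocal L v) =
      quatLocalCoordMap L v hHa hdet (fun i => ((quatCoordEquiv L hHa hdet).symm x i).2 v) := by
  conv_lhs => rw [← (quatCoordEquiv L hHa hdet).apply_symm_apply x]
  rw [coe_quatCoordEquiv, map_adeleToLocal_quatCoord]

/-! ## §3 Integrality of the coordinate lattice -/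

omit [IsCMField L] in
/-- `c • X ∈ M₂(𝒪_{E_v})` for `c ∈ 𝒪_{E_v}`, `X ∈ M₂(𝒪_{E_v})`. [folklore] -/
theorem smul_mem_intMatrices {c : LocalRing L v} (hc : c ∈ localIntegers L v) {X : Matrix (Fin 2) (Fin 2) (LocalRing L v)} (hX : X ∈ intMatrices L 2 v) :
    c • X ∈ intMatrices L 2 v := by
  rw [mem_intMatrices_iff] at hX ⊢
  intro i j
  rw [Matrix.smul_apply, smul_eq_mul]
  exact (localIntegers L v).mul_mem hc (hX i j)

/-- **`M_v(h) ⊆ Λ_v`** as soon as the basis matrices `eᵢ ⊗ 1` are `v`-integral: `∑ ι_v(aᵢ)(eᵢ ⊗ 1)` with `aᵢ ∈ 𝒪_v` lies in `D_v` (§E1) and in `M₂(𝒪_{E_v})`.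
[cite: VignerasLNM800, Ch. III §1] -/
theorem quatLocalCoordLattice_le_quatLocalOrder (hHa : (Ha.map (cmConjRingHom L)).transpose = Ha) (hdet : Ha.det ≠ 0)
    (hint : ∀ i, quatBasisLocal L v hHa hdet i ∈ intMatrices L 2 v) :
    quatLocalCoordLattice L v hHa hdet ≤ quatLocalOrder L Ha v := by
  intro x hx
  obtain ⟨a, ha, rfl⟩ := (mem_quatLocalCoordLattice_iff L v hHa hdet x).1 hx
  refine (mem_quatLocalOrder_iff L Ha v _).2 ⟨quatLocalCoordMap_mem L v hHa hdet a, ?_⟩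
  rw [quatLocalCoordMap_apply]
  exact AddSubgroup.sum_mem _ fun i _ => smul_mem_intMatrices L v ((algebraMap_localRing_mem_localIntegers_iff L v (a i)).2 (ha i)) (hint i)

omit [IsCMField L] in
/-- An element `x ∈ L` is `w`-integral for all but finitely many finite places `w` of `L` (the finite support of its fractional ideal; Mathlib `HeightOneSpectrum.Support.finite`,
as used for `L → 𝔸_L^∞`). [folklore] -/
theorem eventually_coe_mem_adicCompletionIntegers (x : L) :
    ∀ᶠ w : HeightOneSpectrum (𝓞 L) in Filter.cofinite, (x : w.adicCompletion L) ∈ w.adicCompletionIntegers L := by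
  refine ((algebraMap L (FiniteAdeleRing (𝓞 L) L) x).2).mono fun w hw => ?_
  exact hw

omit [NumberField L] [IsCMField L] in
/-- From places of `L` to places of `L⁺`: if a property holds at all but finitely many `w`, then for all but finitely many `v` it holds at every `w ∣ v`. [folklore] -/
theorem eventually_forall_placesOver {P : HeightOneSpectrum (𝓞 L) → Prop} (hP : ∀ᶠ w : HeightOneSpectrum (𝓞 L) in Filter.cofinite, P w) :
    ∀ᶠ v : HeightOneSpectrum (𝓞 ↥(maximalRealSubfield L)) in Filter.cofinite, ∀ w : PlacesOver L v, P w.1 := by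
  rw [Filter.eventually_cofinite] at hP ⊢
  refine (hP.image fun w : HeightOneSpectrum (𝓞 L) => w.under (𝓞 ↥(maximalRealSubfield L))).subset fun v hv => ?_
  simp only [Set.mem_setOf_eq, not_forall] at hv
  obtain ⟨w, hw⟩ := hv
  exact ⟨w.1, hw, w.2⟩

/-- **The basis matrices `eᵢ ⊗ 1` are `v`-integral for all but finitely many `v`.** [cite: VignerasLNM800, Ch. III §1] -/
theorem eventually_quatBasisLocal_mem_intMatrices (hHa : (Ha.map (cmConjRingHom L)).transpose = Ha) (hdet : Ha.det ≠ 0) :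
    ∀ᶠ v : HeightOneSpectrum (𝓞 ↥(maximalRealSubfield L)) in Filter.cofinite, ∀ i, quatBasisLocal L v hHa hdet i ∈ intMatrices L 2 v := by
  have h : ∀ᶠ w : HeightOneSpectrum (𝓞 L) in Filter.cofinite, ∀ i j k,
      ((((quatBasis L Ha hHa hdet i : ↥(quatRatSubalgebra L Ha)) : Matrix (Fin 2) (Fin 2) L) j k : L) : w.adicCompletion L) ∈ w.adicCompletionIntegers L :=
    Filter.eventually_all.2 fun i => Filter.eventually_all.2 fun j => Filter.eventually_all.2 fun k => eventually_coe_mem_adicCompletionIntegers L _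
  filter_upwards [eventually_forall_placesOver L h] with v hv
  intro i
  rw [mem_intMatrices_iff]
  intro j k
  rw [mem_localIntegers_iff_valued]
  intro w
  rw [quatBasisLocal_apply, Matrix.map_apply, Pi.algebraMap_apply, HeightOneSpectrum.algebraMap_adicCompletion, Function.comp_apply,
    Algebra.algebraMap_self, RingHom.id_apply]
  exact (HeightOneSpectrum.mem_adicCompletionIntegers _ _ _).1 (hv w i j k)

/-- **`M_v(h) ⊆ Λ_v` for all but finitely many `v`.** [cite: VignerasLNM800, Ch. III §1] -/
theorem eventually_quatLocalCoordLattice_le_quatLocalOrder (hHa : (Ha.map (cmConjRingHom L)).transpose = Ha) (hdet : Ha.det ≠ 0) :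
    ∀ᶠ v : HeightOneSpectrum (𝓞 ↥(maximalRealSubfield L)) in Filter.cofinite, quatLocalCoordLattice L v hHa hdet ≤ quatLocalOrder L Ha v := by
  filter_upwards [eventually_quatBasisLocal_mem_intMatrices L hHa hdet] with v hv
  exact quatLocalCoordLattice_le_quatLocalOrder L v hHa hdet hv

end Summit.HodgeConjecture.HodgeConjecture.Cruxes.H413.K2E5QuatLocalCoordinates

end
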